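import Summits.Parity.GeneralizedHardyLittlewood.Theorems.PrimeLevelFamEdgeMomentsBeyondDiagonalFarLayersCruxIsHeart
import Summits.Parity.GeneralizedHardyLittlewood.Theorems.PrimeLevelFamEdgeMomentsBeyondDiagonalStubDiag
import Summits.Parity.GeneralizedHardyLittlewood.Theorems.PrimeLevelFamEdgeMomentsBeyondDiagonalFirstMomentAllQ
import Summits.Parity.GeneralizedHardyLittlewood.Theorems.PrimeLevelFamEdgeMomentsBeyondDiagonalTwoOrderIdentification
import Summits.Parity.GeneralizedHardyLittlewood.Theorems.PrimeLevelFamEdgeMomentsBeyondDiagonalLayersFarPOfPascadi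
import HarnessLib

/-!
# Route `PrimeLevelFamEdge`, crux K_A `MomentsBeyondDiagonal` (stmt-Parity-20007), line «petersson_layers» v4:
# AFTER `stub_diag` — the crux is EXACTLY the heart, UNCONDITIONALLY (kernel equivalences with all satellites discharged by name)

State of the registered line after p841811 (`stub_diag : SubDiag`), p803664 (`stub_first : SubFirst`), p795653
(`stub_identP : TailNearFar ρ_P`), p810002 (`subFar_rhoWeil : SubFar ρ_W`) and the Pascadi reduction
`subFar_rhoP_of_pascadi : pascadi2025_theorem71 → SubFar ρ_P`: every hypothesis of the equivalence files
`…FarLayersCruxIsHeart` (`KA_iff_subHeart_rhoWeil : SubDiag → (K_A ↔ SubHeart ρ_W)`) and `…CoreIsCrux`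
(`momentsBeyondDiagonal_iff_subTail_rhoEmpty : SubFirst → SubDiag → (K_A ↔ SubTail ρ_∅)`) that is a SATELLITE is now a
theorem of the tree, so the equivalences hold outright:

* `momentsBeyondDiagonal_iff_subHeart_rhoWeil : MomentsBeyondDiagonal ↔ SubHeart rhoWeil` — **K_A is, with no hypothesis left,
  the statement that the first `⌊q̂^{4Δ'−3/2}⌋` explicit Petersson layers `Σ_{r ≤ q̂^{4Δ'−3/2}} K_r` of the mollified second moment
  have a level-free main term on some window beyond the diagonal** (BN-7a's wall with both flanks removed);
* `momentsBeyondDiagonal_iff_subTail_rhoEmpty : MomentsBeyondDiagonal ↔ SubTail rhoEmpty` — equivalently, the whole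
  off-diagonal `Q^h − D` has a level-free main term;
* inside the heart: `K_A ↔ SubUpper ρ_W` given the rung, `K_A ↔ SubRung` given the upper layers (one wall stub trades for K_A);
* at the PRINT cut, CONDITIONAL on Pascadi's Theorem 7.1 (statement layer `pascadi2025_theorem71`, not proved in the tree):
  `SubTail ρ_P`, `K_A ↔ SubHeart rhoP`, and the line's composition with every satellite discharged —
  `momentsBeyondDiagonal_of_wall_of_pascadi : SubRung → SubUpper rhoCore → SubBand rhoCore rhoP → pascadi2025_theorem71 → K_A`
  (the three registered wall stubs `stub_rung`, `stub_core`, `stub_band` plus the print input give the crux BY NAME).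

HONEST LABEL: bookkeeping over landed theorems (def-free, one-line proofs); NO registered stub is closed here; `SubHeart ρ_W`
(registry famE-02: the second moment beyond the diagonal at one prime level) is OPEN IN PRINT; K_A, K_B and the Parity summit are
NOT proved; nothing about GRH or Landau–Siegel zeros. Seat leafhand-parity-primelevelfamedge-1 g21, 2026-09-01.
-/

noncomputable section

namespace Summit.Parity.GeneralizedHardyLittlewood.Theorems.MomentsBeyondDiagonal.AfterDiag

open Summit.Parity.GeneralizedHardyLittlewood.Theses.PrimeLevelFamEdge (MomentsBeyondDiagonal)
open Summit.Parity.GeneralizedHardyLittlewood.Theorems.PrimeLevelFamEdgeIdeaDeltas.PairsSplit (SubFirst)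
open Summit.Parity.GeneralizedHardyLittlewood.Theorems.PrimeLevelFamEdgeIdeaDeltas.PeterssonLayers
open Summit.Parity.GeneralizedHardyLittlewood.Theorems.MomentsBeyondDiagonal.DiagCorner (stub_diag)
open Summit.Parity.GeneralizedHardyLittlewood.Theorems.MomentsBeyondDiagonal.FirstOrderAFE (stub_first)
open Summit.Parity.GeneralizedHardyLittlewood.Theorems.MomentsBeyondDiagonal.TwoOrderAFE (stub_identP)
open Summit.Parity.GeneralizedHardyLittlewood.Theorems.MomentsBeyondDiagonal.FarLayers
  (KA_iff_subHeart_rhoWeil subTail_rhoWeil subFar_rhoWeil)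
open Summit.Parity.GeneralizedHardyLittlewood.Theorems.MomentsBeyondDiagonal.Layers (subFar_rhoP_of_pascadi)
open Literature.NumberTheory.LFunctions (pascadi2025_theorem71)

/-! ## §1. Unconditional: the crux is the heart at the Weil cut / the whole off-diagonal -/

/-- **K_A ⟺ the heart at the Weil cut has the printed shape — UNCONDITIONALLY.** `MomentsBeyondDiagonal ↔ SubHeart rhoWeil`:
`KA_iff_subHeart_rhoWeil` (p810483's lineage) with its only hypothesis `SubDiag` discharged by `stub_diag` (p841811). -/
theorem momentsBeyondDiagonal_iff_subHeart_rhoWeil : MomentsBeyondDiagonal ↔ SubHeart rhoWeil :=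
  KA_iff_subHeart_rhoWeil stub_diag

/-- **K_A ⟺ the whole off-diagonal `Q^h − D` has the printed shape — UNCONDITIONALLY.** `MomentsBeyondDiagonal ↔ SubTail rhoEmpty`:
`momentsBeyondDiagonal_iff_subTail_rhoEmpty` with `SubFirst` (`stub_first`, p803664) and `SubDiag` (`stub_diag`, p841811). -/
theorem momentsBeyondDiagonal_iff_subTail_rhoEmpty : MomentsBeyondDiagonal ↔ SubTail rhoEmpty :=
  Summit.Parity.GeneralizedHardyLittlewood.Theorems.PrimeLevelFamEdgeIdeaDeltas.PeterssonLayers.momentsBeyondDiagonal_iff_subTail_rhoEmpty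
    stub_first stub_diag

/-- The heart at the Weil cut, FROM K_A (unconditional direction of use to a refuter: a level-dependent oscillation of
`Σ_{r ≤ q̂^{4Δ'−3/2}} K_r / (q̂ log⁻² q̂)` on every window refutes K_A). -/
theorem subHeart_rhoWeil_of_momentsBeyondDiagonal (h : MomentsBeyondDiagonal) : SubHeart rhoWeil :=
  momentsBeyondDiagonal_iff_subHeart_rhoWeil.mp h

/-- K_A FROM the heart at the Weil cut (the direction a prover needs: `SubHeart rhoWeil` alone now closes the crux). -/
theorem momentsBeyondDiagonal_of_subHeart_rhoWeil (h : SubHeart rhoWeil) : MomentsBeyondDiagonal :=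
  momentsBeyondDiagonal_iff_subHeart_rhoWeil.mpr h

/-! ## §2. Inside the heart: one wall stub trades for K_A -/

/-- Given the RUNG (`stub_rung`), K_A ⟺ the upper layers `2 ≤ r ≤ q̂^{4Δ'−3/2}` have the printed shape. -/
theorem momentsBeyondDiagonal_iff_subUpper_rhoWeil (hR : SubRung) : MomentsBeyondDiagonal ↔ SubUpper rhoWeil :=
  ⟨fun h ↦ subUpper_of_rung_heart rhoWeil (fun Δ' hΔ' ↦ (rhoWeil_pos Δ' hΔ').le) hR
      (subHeart_rhoWeil_of_momentsBeyondDiagonal h),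
    fun hU ↦ momentsBeyondDiagonal_of_subHeart_rhoWeil
      (subHeart_of_rung_upper rhoWeil (fun Δ' hΔ' ↦ (rhoWeil_pos Δ' hΔ').le) hR hU)⟩

/-- Given the UPPER layers at the Weil cut, K_A ⟺ the rung `r = 1` (modulus `q`) has the printed shape. -/
theorem momentsBeyondDiagonal_iff_subRung (hU : SubUpper rhoWeil) : MomentsBeyondDiagonal ↔ SubRung :=
  ⟨fun h ↦ subRung_of_upper_heart rhoWeil (fun Δ' hΔ' ↦ (rhoWeil_pos Δ' hΔ').le) hU
      (subHeart_rhoWeil_of_momentsBeyondDiagonal h),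
    fun hR ↦ momentsBeyondDiagonal_of_subHeart_rhoWeil
      (subHeart_of_rung_upper rhoWeil (fun Δ' hΔ' ↦ (rhoWeil_pos Δ' hΔ').le) hR hU)⟩

/-! ## §3. At the print cut, conditional on Pascadi's Theorem 7.1 -/

/-- The difference-defined tail at the PRINT cut has the printed shape, given Pascadi's Theorem 7.1:
`stub_identP` (p795653) + `subFar_rhoP_of_pascadi`. [cite: Pascadi2025, Thm. 7.1] -/
theorem subTail_rhoP_of_pascadi (h : pascadi2025_theorem71) : SubTail rhoP :=
  subTail_of_ident_far rhoP stub_identP (subFar_rhoP_of_pascadi h)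

/-- **Given Pascadi's Theorem 7.1, K_A ⟺ the heart at the PRINT cut `Σ_{r ≤ q̂^{ρ_P}} K_r`,
`ρ_P = max(5Δ'−4, 8Δ'−8) + 1/10`, has the printed shape** (the wall shrinks from `(0, 4Δ'−3/2]` to `(0, ρ_P]` in the layer
exponent). [cite: Pascadi2025, Thm. 7.1] -/
theorem momentsBeyondDiagonal_iff_subHeart_rhoP (h : pascadi2025_theorem71) : MomentsBeyondDiagonal ↔ SubHeart rhoP :=
  ⟨fun hK ↦ subHeart_of_KA_diag_tail rhoP hK stub_diag (subTail_rhoP_of_pascadi h),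
    fun hH ↦ MomentsBeyondDiagonal_of_layerSplit rhoP stub_first stub_diag hH (subTail_rhoP_of_pascadi h)⟩

/-- **THE STATE OF THE LINE (v4) with every satellite discharged by name:** the three registered WALL stubs
`stub_rung : SubRung`, `stub_core : SubUpper rhoCore`, `stub_band : SubBand rhoCore rhoP` together with Pascadi's Theorem 7.1
give the crux `MomentsBeyondDiagonal` — the registered composition `MomentsBeyondDiagonal_of_sevenSplitBands` with
`stub_first`, `stub_diag`, `stub_identP` and `subFar_rhoP_of_pascadi` plugged in. [cite: Pascadi2025, Thm. 7.1] -/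
theorem momentsBeyondDiagonal_of_wall_of_pascadi (h3 : SubRung) (h4 : SubUpper rhoCore) (h5 : SubBand rhoCore rhoP)
    (h : pascadi2025_theorem71) : MomentsBeyondDiagonal :=
  MomentsBeyondDiagonal_of_sevenSplitBands stub_first stub_diag h3 h4 h5 stub_identP (subFar_rhoP_of_pascadi h)

/-- Without Pascadi, at the Weil cut: the two wall pieces `stub_rung : SubRung` and `SubUpper rhoWeil` (core + both bands up to
`q̂^{4Δ'−3/2}`) give the crux, every other input being a theorem of the tree. -/
theorem momentsBeyondDiagonal_of_rung_upperWeil (h3 : SubRung) (h4 : SubUpper rhoWeil) : MomentsBeyondDiagonal :=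
  MomentsBeyondDiagonal_of_sixSplitWeil stub_first stub_diag h3 h4 (tailNearFar_rhoWeil_of_rhoP stub_identP) subFar_rhoWeil

end Summit.Parity.GeneralizedHardyLittlewood.Theorems.MomentsBeyondDiagonal.AfterDiag

end
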